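import Summits.QuantumFields.BalabanUV.Beta.GAN24.ChargeTowerInduction

/-!
# `BalabanUV.Beta.GAN24.ChargeTowerSameDirection` — binder row G-an2-4 ∕ (CONV-C), the (S) row ∕ (W-γ) AT EVERY LEVEL («the Δ_j-exact charge tower», road-P2 gen 42, companion
# of `ChargeTowerInduction`): **THE SAME-DIRECTION exit⊗exit CHARGE FUNCTION VANISHES AT EVERY LEVEL** — for `α = β` the tower carries the ZERO potential: the `Lc·M`-exit⊗exit
# charge of `S_{j+1}` in the channel `(inl α, inl α)` is `0` at every slot, every `j`, every `M ≥ 1` (E28 (B): «same-direction channels ≡ 0» at jb = 0 AND jb = 1 — now a theorem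
# at every level)

NOT IN PRINT; OUR BOOKKEEPING ([folklore] by name: leaf-02 g57's PART B `SrecChargeBlockPotentials.tsum_prod_exitWt_srecAt_zero` with PART A's
`WilsonPairFormCharge.curvAdj_curv_pairForm_coord_same` (the same-direction pair form has zero Maxwell image), PART D `SrecChargeLamDropsAllLevels.tsum_prod_exitWt_srecAt_eq_spureRecAt`,
the typed rungs `ChargeTowerClimbZero` §4 ∕ `ChargeTowerClimb` §7 run with the ZERO potential, and (W) `ChargeTowerInduction.exitWt_blk_eq`; 0 `def`, 0 cited fact, 0 `def … : Prop`,
0 sorry).  HONEST FRAMING (cell contract, verbatim): «discharging `BetaPertH` makes Bałaban's UV stability UNCONDITIONAL — a real constructive-QFT result; it is NOT the continuum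
limit and NOT the Clay problem.»  HONEST DEPENDENCY (verbatim): «continuum YM on T⁴ ⇐ BetaPertH ∧ nine spine estimates (0/9 proved); BetaPertH ⇐ (D1) ∧ (D4) ∧ CAP+tail; G-an2-4
gates asym, D1 and NE2/3/4.»

* §1 `curvAdj_curv_zero`, `contourSum_zero'`, **`exitCharge_srecAt_zero_same`** (THE BASE, `α = β`, every `M ≥ 1`: the level-0 charge of the FULL member against the pulled-back weights in
  the channel `(inl α, inl α)` is `1·(d*d 0) + 0` — PART B with the staircase primitives ⨾ `curvAdj_curv_pairForm_coord_same`).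
* §2 **`tower_same_zero`** (first rung: `ChargeTowerClimbZero` §4 with `m = 0`, `a = 1`, `c = 0`; the climbed zero potential is zero), **`tower_same_succ`** (rung `j+1 → j+2`: PART D ⨾ (W)
  ⨾ `ChargeTowerClimb` §7 with `m = 0`, `c = 0`), **`tower_same`** (induction, `M ↦ Lc·M`): `∀ j, ∀ M ≥ 1, ∀ ν y′,
  Σ'_{(x,z)} 𝟙^{exit,Lc·M}_α(x)·𝟙^{exit,Lc·M}_α(z)·SpureRecAt … (j+1) ν y′ x z (inl α)(inl α) = 0`.
* §3 `M = 1`: **`tsum_exitCharge_same_eq_zero`** (pure member) and **`tsum_exitCharge_same_srecAt_eq_zero`** (full member, PART D).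
READING.  With `ChargeTowerExitOrthogonal` (`α ≠ β`: `Δ_{j+1}`-exact with an `Lc`-periodic potential, ⟂ every `ℋ`-column) this completes the exit⊗exit block of the class
`𝒞 = span{1, exit} ⊗ span{1, exit}` at every level: cross-direction channels exact-and-orthogonal, same-direction channels identically zero.  Asserts NO value of Bałaban's tables
beyond these zeros; NOTHING of the (γ)∕(α⁺) pairing ∕ (INV) ∕ (S) ∕ (Q-R) ∕ (LT) ∕ (Q-L) ∕ (C) discharged; NEVER «G-an2-4 closed» as (CONV-C); NOT D1, NOT `BetaPertH`, NOT continuum, NOT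
Clay.  2026-08-22; no existing file touched.
-/

noncomputable section

open Finset
open scoped BigOperators
open Literature.MathematicalPhysics.QuantumFieldTheory
open Literature.MathematicalPhysics.QuantumFieldTheory.Balaban1983to89
open Literature.MathematicalPhysics.QuantumFieldTheory.Balaban1983to89.Beta
open ExpKernelCalculus (Site MKer)
open AffineAveraging (Form1 Form2 box toSite unitVec dz curv curvAdj contourSum)
open AveragingContours (blk)
open KernelSpecInstance (wΦ)
open OneStepResolventKernel (Fib)
open OneStepKernelFamily (KInvStep)
open BalabanStepJetsSucc (wVH wE)
open Summit.QuantumFields.BalabanUV.Beta.AxialDressingRooted (IsCombBondAt coDressKBmAt one_le_of_neZero)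
open Summit.QuantumFields.BalabanUV.Beta.BorderedHessian (stepScale)
open Summit.QuantumFields.BalabanUV.Beta.SpineRooted (SpureRecAt)
open Summit.QuantumFields.BalabanUV.Beta.WardLocusRecursive (SrecAt)
open Summit.QuantumFields.BalabanUV.Beta.GAN24.WilsonPairFormCharge (curvAdj_curv_pairForm_coord_same)
open Summit.QuantumFields.BalabanUV.Beta.GAN24.SrecChargeBlockPotentials (tsum_prod_exitWt_srecAt_zero curvAdj_curv_const_mul)
open Summit.QuantumFields.BalabanUV.Beta.GAN24.SrecChargeLamDropsAllLevels (tsum_prod_exitWt_srecAt_eq_spureRecAt)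
open Summit.QuantumFields.BalabanUV.Beta.GAN24.ChargeTowerClimb (hasSum_prod_coordWeighted_SpureRecAt_of_exact_add_const)
open Summit.QuantumFields.BalabanUV.Beta.GAN24.ChargeTowerClimbZero (hasSum_prod_coordWeighted_SpureRecAt_one_of_exact_add_const)
open Summit.QuantumFields.BalabanUV.Beta.GAN24.ChargeTowerInduction (exitWt_blk_eq abs_exitInd_le_one staircase_forwardDiff)

namespace Summit.QuantumFields.BalabanUV.Beta.GAN24.ChargeTowerSameDirection

variable {d : ℕ} {Lc : ℕ} [NeZero Lc] {r : Fin (d + 1) → ℕ}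

/-! ## §1 The base: the same-direction pair form has zero Maxwell image -/

omit [NeZero Lc] in
/-- [folklore] `d*d 0 = 0` (pointwise). -/
theorem curvAdj_curv_zero (κ : Fin (d + 1)) (u : Site (d + 1)) : curvAdj (curv (fun (_ : Fin (d + 1)) (_ : Site (d + 1)) => (0 : ℝ))) κ u = 0 := by
  simp only [AffineAveraging.curvAdj, AffineAveraging.curv, add_zero, sub_self, Finset.sum_const_zero]

omit [NeZero Lc] in
/-- [folklore] `𝒬_{Lc} 0 = 0` (pointwise). -/
theorem contourSum_zero' (κ : Fin (d + 1)) (y : Site (d + 1)) : contourSum Lc (fun (_ : Fin (d + 1)) (_ : Site (d + 1)) => (0 : ℝ)) κ y = 0 := by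
  simp only [AffineAveraging.contourSum, Finset.sum_const_zero]

/-- NOT IN PRINT; OUR BOOKKEEPING.  **THE BASE, SAME DIRECTION** (in-block root, all `cE cVH cΛ`, every `M ≥ 1`, every slot): the level-0 charge function of the FULL member
`SrecAt … 0` against the pulled-back weights `𝟙^{exit,Lc}_α·𝟙^{exit,Lc·M}(blk_α) ⊗ 𝟙^{exit,Lc}_α·𝟙^{exit,Lc·M}(blk_α)` in the channel `(inl α, inl α)` is `1·(d*d 0)_κ(u) + 0` — PART B
`tsum_prod_exitWt_srecAt_zero` with the staircase primitives `⌊·∕(Lc·M)⌋`, then `curvAdj_curv_pairForm_coord_same` (the same-direction pair form is supported on `α`-bonds with an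
`α`-only dependence: zero curl image).  The hypothesis `hC` of `ChargeTowerClimbZero` §4 with the ZERO potential. -/
theorem exitCharge_srecAt_zero_same (hr : r ∈ box (d + 1) Lc) (cE cVH cΛ : ℝ) (α : Fin (d + 1)) {M : ℕ} (hM : 1 ≤ M)
    (κ : Fin (d + 1)) (u : Site (d + 1)) :
    ∑' xz : Site (d + 1) × Site (d + 1),
        (if xz.1 α % (Lc : ℤ) = (Lc : ℤ) - 1 then (if blk Lc xz.1 α % ((Lc * M : ℕ) : ℤ) = ((Lc * M : ℕ) : ℤ) - 1 then (1 : ℝ) else 0) else 0)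
          * (if xz.2 α % (Lc : ℤ) = (Lc : ℤ) - 1 then (if blk Lc xz.2 α % ((Lc * M : ℕ) : ℤ) = ((Lc * M : ℕ) : ℤ) - 1 then (1 : ℝ) else 0) else 0)
          * SrecAt d Lc (toSite r) cE cVH cΛ 0 κ u xz.1 xz.2 (Sum.inl α) (Sum.inl α)
      = 1 * curvAdj (curv (fun (_ : Fin (d + 1)) (_ : Site (d + 1)) => (0 : ℝ))) κ u + (fun _ : Fin (d + 1) => (0 : ℝ)) κ := by
  classical
  have hLc : 1 ≤ Lc := one_le_of_neZero Lc
  have hLM : 1 ≤ Lc * M := Nat.one_le_iff_ne_zero.2 (Nat.mul_ne_zero (by omega) (by omega))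
  have hF : ∀ t : ℤ, (((((t + 1) / ((Lc * M : ℕ) : ℤ) : ℤ)) : ℝ)) - (((t / ((Lc * M : ℕ) : ℤ) : ℤ)) : ℝ)
      = if t % ((Lc * M : ℕ) : ℤ) = ((Lc * M : ℕ) : ℤ) - 1 then (1 : ℝ) else 0 := staircase_forwardDiff hLM
  have hB := tsum_prod_exitWt_srecAt_zero hLc hr cE cVH cΛ (F₁ := fun t : ℤ => (((t / ((Lc * M : ℕ) : ℤ) : ℤ)) : ℝ))
    (F₂ := fun t : ℤ => (((t / ((Lc * M : ℕ) : ℤ) : ℤ)) : ℝ)) hF hF (fun s => abs_exitInd_le_one _ s) (fun s => abs_exitInd_le_one _ s) κ u α α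
  rw [hB, curvAdj_curv_const_mul, curvAdj_curv_pairForm_coord_same (fun t => (((t / (Lc : ℤ) / ((Lc * M : ℕ) : ℤ) : ℤ)) : ℝ))
    (fun t => (((t / (Lc : ℤ) / ((Lc * M : ℕ) : ℤ) : ℤ)) : ℝ)) α κ u, mul_zero, curvAdj_curv_zero, mul_zero, add_zero]

/-! ## §2 The rungs with the zero potential, and the induction -/

/-- NOT IN PRINT; OUR BOOKKEEPING.  **THE FIRST RUNG, SAME DIRECTION** (in-block root, all `cE cVH cΛ`, every `M ≥ 1`): `∀ ν y′,
Σ'_{(x,z)} 𝟙^{exit,Lc·M}_α(x)·𝟙^{exit,Lc·M}_α(z)·SpureRecAt … (0+1) ν y′ x z (inl α)(inl α) = 0` — `ChargeTowerClimbZero` §4 with `m = 0`, `a = 1`, `c = 0` on §1; the climbed zero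
potential is zero. -/
theorem tower_same_zero (hr : r ∈ box (d + 1) Lc) (cE cVH cΛ : ℝ) (α : Fin (d + 1)) {M : ℕ} (hM : 1 ≤ M) (ν : Fin (d + 1)) (y' : Site (d + 1)) :
    ∑' xz : Site (d + 1) × Site (d + 1),
        (if xz.1 α % ((Lc * M : ℕ) : ℤ) = ((Lc * M : ℕ) : ℤ) - 1 then (1 : ℝ) else 0) * (if xz.2 α % ((Lc * M : ℕ) : ℤ) = ((Lc * M : ℕ) : ℤ) - 1 then (1 : ℝ) else 0)
          * SpureRecAt d Lc (toSite r) cE cVH cΛ (0 + 1) ν y' xz.1 xz.2 (Sum.inl α) (Sum.inl α) = 0 := by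
  classical
  have hC := exitCharge_srecAt_zero_same hr cE cVH cΛ α hM
  have h4 := hasSum_prod_coordWeighted_SpureRecAt_one_of_exact_add_const hr cE cVH cΛ α α
    (fun s : ℤ => if s % ((Lc * M : ℕ) : ℤ) = ((Lc * M : ℕ) : ℤ) - 1 then (1 : ℝ) else 0)
    (fun s : ℤ => if s % ((Lc * M : ℕ) : ℤ) = ((Lc * M : ℕ) : ℤ) - 1 then (1 : ℝ) else 0)
    (fun s => abs_exitInd_le_one _ s) (fun s => abs_exitInd_le_one _ s)
    (m := fun (_ : Fin (d + 1)) (_ : Site (d + 1)) => (0 : ℝ)) (B := 0) (fun _ _ => by rw [abs_zero]) (fun _ _ _ => rfl) 1 (fun _ => (0 : ℝ)) hC ν y'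
  rw [h4.tsum_eq]
  simp only [contourSum_zero', mul_zero, Finset.sum_const_zero, tsum_zero, zero_mul, add_zero]

/-- NOT IN PRINT; OUR BOOKKEEPING.  **THE RUNG `j+1 → j+2`, SAME DIRECTION** (in-block root, all `cE cVH cΛ`, `M ≥ 1`): if the `Lc·(Lc·M)`-exit⊗exit same-direction charge of
`S_{j+1}` vanishes at every slot, so does the `Lc·M`-exit⊗exit one of `S_{j+2}` — PART D (pure → full) ⨾ (W) ⨾ `ChargeTowerClimb` §7 with `m = 0`, `c = 0`. -/
theorem tower_same_succ (hr : r ∈ box (d + 1) Lc) (cE cVH cΛ : ℝ) (α : Fin (d + 1)) (j : ℕ) {M : ℕ} (hM : 1 ≤ M)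
    (hT : ∀ (κ : Fin (d + 1)) (u : Site (d + 1)), ∑' xz : Site (d + 1) × Site (d + 1),
        (if xz.1 α % ((Lc * (Lc * M) : ℕ) : ℤ) = ((Lc * (Lc * M) : ℕ) : ℤ) - 1 then (1 : ℝ) else 0)
          * (if xz.2 α % ((Lc * (Lc * M) : ℕ) : ℤ) = ((Lc * (Lc * M) : ℕ) : ℤ) - 1 then (1 : ℝ) else 0)
          * SpureRecAt d Lc (toSite r) cE cVH cΛ (j + 1) κ u xz.1 xz.2 (Sum.inl α) (Sum.inl α) = 0)
    (ν : Fin (d + 1)) (y' : Site (d + 1)) :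
    ∑' xz : Site (d + 1) × Site (d + 1),
        (if xz.1 α % ((Lc * M : ℕ) : ℤ) = ((Lc * M : ℕ) : ℤ) - 1 then (1 : ℝ) else 0) * (if xz.2 α % ((Lc * M : ℕ) : ℤ) = ((Lc * M : ℕ) : ℤ) - 1 then (1 : ℝ) else 0)
          * SpureRecAt d Lc (toSite r) cE cVH cΛ (j + 2) ν y' xz.1 xz.2 (Sum.inl α) (Sum.inl α) = 0 := by
  classical
  have hLc : 1 ≤ Lc := one_le_of_neZero Lc
  have hLM : 1 ≤ Lc * M := Nat.one_le_iff_ne_zero.2 (Nat.mul_ne_zero (by omega) (by omega))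
  -- the hypothesis `hC` of `ChargeTowerClimb` §7 on the FULL member with the zero potential
  have hC : ∀ (κ : Fin (d + 1)) (u : Site (d + 1)), ∑' yw : Site (d + 1) × Site (d + 1),
      (if yw.1 α % (Lc : ℤ) = (Lc : ℤ) - 1 then (if blk Lc yw.1 α % ((Lc * M : ℕ) : ℤ) = ((Lc * M : ℕ) : ℤ) - 1 then (1 : ℝ) else 0) else 0)
        * (if yw.2 α % (Lc : ℤ) = (Lc : ℤ) - 1 then (if blk Lc yw.2 α % ((Lc * M : ℕ) : ℤ) = ((Lc * M : ℕ) : ℤ) - 1 then (1 : ℝ) else 0) else 0)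
        * SrecAt d Lc (toSite r) cE cVH cΛ (j + 1) κ u yw.1 yw.2 (Sum.inl α) (Sum.inl α)
      = (wVH d Lc (j + 1) * ∑' v, ∑ l : Fin (d + 1), wΦ (N := Lc ^ (j + 1)) κ l (u - v) * (fun (_ : Fin (d + 1)) (_ : Site (d + 1)) => (0 : ℝ)) l v)
        + (fun _ : Fin (d + 1) => (0 : ℝ)) κ := by
    intro κ u
    have hD := tsum_prod_exitWt_srecAt_eq_spureRecAt hLc hr cE cVH cΛ (j + 1)
      (f₁ := fun s : ℤ => if s % ((Lc * M : ℕ) : ℤ) = ((Lc * M : ℕ) : ℤ) - 1 then (1 : ℝ) else 0)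
      (f₂ := fun s : ℤ => if s % ((Lc * M : ℕ) : ℤ) = ((Lc * M : ℕ) : ℤ) - 1 then (1 : ℝ) else 0)
      (fun s => abs_exitInd_le_one _ s) (fun s => abs_exitInd_le_one _ s) κ u α α
    rw [hD]
    simp only [mul_zero, Finset.sum_const_zero, tsum_zero, add_zero]
    refine Eq.trans (tsum_congr fun yw => ?_) (hT κ u)
    rw [exitWt_blk_eq hLc hLM yw.1 α, exitWt_blk_eq hLc hLM yw.2 α]
  have h7 := hasSum_prod_coordWeighted_SpureRecAt_of_exact_add_const hr cE cVH cΛ j α α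
    (fun s : ℤ => if s % ((Lc * M : ℕ) : ℤ) = ((Lc * M : ℕ) : ℤ) - 1 then (1 : ℝ) else 0)
    (fun s : ℤ => if s % ((Lc * M : ℕ) : ℤ) = ((Lc * M : ℕ) : ℤ) - 1 then (1 : ℝ) else 0)
    (fun s => abs_exitInd_le_one _ s) (fun s => abs_exitInd_le_one _ s)
    (m := fun (_ : Fin (d + 1)) (_ : Site (d + 1)) => (0 : ℝ)) (B := 0) (fun _ _ => by rw [abs_zero]) (fun _ _ _ => rfl) (fun _ => (0 : ℝ)) hC ν y'
  rw [h7.tsum_eq]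
  simp only [contourSum_zero', mul_zero, Finset.sum_const_zero, tsum_zero, zero_mul, add_zero]

/-- NOT IN PRINT; OUR BOOKKEEPING.  **THE SAME-DIRECTION exit⊗exit CHARGE FUNCTION VANISHES AT EVERY LEVEL, EVERY EXTRA PERIOD** (in-block root, all `cE cVH cΛ`; induction on
`j` with `M ↦ Lc·M` in the hypothesis): `∀ j, ∀ M ≥ 1, ∀ ν y′, Σ'_{(x,z)} 𝟙^{exit,Lc·M}_α(x)·𝟙^{exit,Lc·M}_α(z)·SpureRecAt … (j+1) ν y′ x z (inl α)(inl α) = 0`. -/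
theorem tower_same (hr : r ∈ box (d + 1) Lc) (cE cVH cΛ : ℝ) (α : Fin (d + 1)) (j : ℕ) :
    ∀ {M : ℕ}, 1 ≤ M → ∀ (ν : Fin (d + 1)) (y' : Site (d + 1)), ∑' xz : Site (d + 1) × Site (d + 1),
        (if xz.1 α % ((Lc * M : ℕ) : ℤ) = ((Lc * M : ℕ) : ℤ) - 1 then (1 : ℝ) else 0) * (if xz.2 α % ((Lc * M : ℕ) : ℤ) = ((Lc * M : ℕ) : ℤ) - 1 then (1 : ℝ) else 0)
          * SpureRecAt d Lc (toSite r) cE cVH cΛ (j + 1) ν y' xz.1 xz.2 (Sum.inl α) (Sum.inl α) = 0 := by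
  induction j with
  | zero => exact fun hM ν y' => tower_same_zero hr cE cVH cΛ α hM ν y'
  | succ j ih =>
    intro M hM ν y'
    have hLM : 1 ≤ Lc * M := Nat.one_le_iff_ne_zero.2 (Nat.mul_ne_zero (NeZero.ne Lc) (by omega))
    exact tower_same_succ hr cE cVH cΛ α j hM (fun κ u => ih hLM κ u) ν y'

/-! ## §3 `M = 1`: the pure exit class, pure and full member -/

/-- NOT IN PRINT; OUR BOOKKEEPING.  **SAME DIRECTION, THE PURE EXIT CLASS, EVERY LEVEL** (in-block root, all `cE cVH cΛ`, every `j`, every slot):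
`Σ'_{(x,z)} 𝟙[x_α % Lc = Lc−1]·𝟙[z_α % Lc = Lc−1]·SpureRecAt … (j+1) ν y′ x z (inl α)(inl α) = 0`. -/
theorem tsum_exitCharge_same_eq_zero (hr : r ∈ box (d + 1) Lc) (cE cVH cΛ : ℝ) (α : Fin (d + 1)) (j : ℕ) (ν : Fin (d + 1)) (y' : Site (d + 1)) :
    ∑' xz : Site (d + 1) × Site (d + 1),
        (if xz.1 α % (Lc : ℤ) = (Lc : ℤ) - 1 then (1 : ℝ) else 0) * (if xz.2 α % (Lc : ℤ) = (Lc : ℤ) - 1 then (1 : ℝ) else 0)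
          * SpureRecAt d Lc (toSite r) cE cVH cΛ (j + 1) ν y' xz.1 xz.2 (Sum.inl α) (Sum.inl α) = 0 := by
  have h := tower_same hr cE cVH cΛ α j (M := 1) le_rfl ν y'
  simp only [Nat.mul_one] at h
  exact h

/-- NOT IN PRINT; OUR BOOKKEEPING.  **THE SAME FOR THE FULL MEMBER `SrecAt … (j+1)`** (PART D). -/
theorem tsum_exitCharge_same_srecAt_eq_zero (hr : r ∈ box (d + 1) Lc) (cE cVH cΛ : ℝ) (α : Fin (d + 1)) (j : ℕ) (ν : Fin (d + 1)) (y' : Site (d + 1)) :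
    ∑' xz : Site (d + 1) × Site (d + 1),
        (if xz.1 α % (Lc : ℤ) = (Lc : ℤ) - 1 then (1 : ℝ) else 0) * (if xz.2 α % (Lc : ℤ) = (Lc : ℤ) - 1 then (1 : ℝ) else 0)
          * SrecAt d Lc (toSite r) cE cVH cΛ (j + 1) ν y' xz.1 xz.2 (Sum.inl α) (Sum.inl α) = 0 := by
  have hLc : 1 ≤ Lc := one_le_of_neZero Lc
  have hD := tsum_prod_exitWt_srecAt_eq_spureRecAt hLc hr cE cVH cΛ (j + 1) (f₁ := fun _ : ℤ => (1 : ℝ)) (f₂ := fun _ : ℤ => (1 : ℝ))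
    (B₁ := 1) (B₂ := 1) (fun _ => by rw [abs_one]) (fun _ => by rw [abs_one]) ν y' α α
  rw [hD]
  exact tsum_exitCharge_same_eq_zero hr cE cVH cΛ α j ν y'

end Summit.QuantumFields.BalabanUV.Beta.GAN24.ChargeTowerSameDirection

end
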